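import Summits.BirchSwinnertonDyer.BirchSwinnertonDyer.Theses.SignedLowerHalves
import Summits.BirchSwinnertonDyer.BirchSwinnertonDyer.Theorems.SignedLowerHalvesKobayashiMainConjectureSmallImageAcnsCrux
import Summits.BirchSwinnertonDyer.BirchSwinnertonDyer.Theorems.SignedLowerHalvesKobayashiMainConjectureSmallImageAcanchorGlueRatRatNotCMCoprime
import Summits.BirchSwinnertonDyer.BirchSwinnertonDyer.Theorems.SignedLowerHalvesKobayashiMainConjectureSmallImageCycWindingMuThree
import Summits.BirchSwinnertonDyer.BirchSwinnertonDyer.Theorems.SignedLowerHalvesKobayashiMainConjectureSmallImagePublishedInputsNsOfFiveOfMazur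
import Summits.BirchSwinnertonDyer.BirchSwinnertonDyer.Theorems.SignedLowerHalvesKobayashiLowerHalfLargeImageHorocycleMuFloor
import HarnessLib

/-!
# Route `SignedLowerHalves` (K3), rev 17: the GLUE of the split of crux 4 `KobayashiMainConjectureSmallImage`
# (stmt-BirchSwinnertonDyer-19002) into the five children of line `birth_acns` v13 — item stmt-BirchSwinnertonDyer-23120
# `KobayashiMainConjectureSmallImageOfAcnsParts`, PROVED (cell `bsd-ssimc`, LEAD seat `bsd-line-slh-p3` gen 11)

The tenure planner's turnkey #2 v3 (K3 rev 16 → 17, commit b8e68bfcb4e9, 2026-08-28T18:38Z) promoted the six stubs of the registered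
line `Cruxes/KobayashiMainConjectureSmallImage/Lines/birth_acns.lean` v13 (skeleton sha16 8959f4935fd86146) to route items, VERBATIM:
C1 `SmallImageEulerSystemRat` (stmt-23115 = `stub_ES2rat_ns`, T2_rat¬CM,h), C2 `SmallImageAcDivRat` (stmt-23116 = `stub_acDivRat_ns`,
T1_rat¬CM,h), C3 `SmallImageOneSignUnitContent` (stmt-23117 = `stub_muOneSign_ns_ge5`), C4 `SmallImageLambdaLowerAtThree` (stmt-23118 =
`stub_lambdaLowerThree_ns`), C5 `SmallImagePublishedPreprintInputs` (stmt-23119 = `stub_publishedInputs_ns ∧ stub_preprintInputs_ns`), with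
the glue item `KobayashiMainConjectureSmallImageOfAcnsParts := C1 → C2 → C3 → C4 → C5 → KobayashiMainConjectureSmallImage` (stmt-23120).
This file PROVES the glue: it is line v13's composition `BirthAcns.KobayashiMainConjectureSmallImage_of` re-threaded over the children as
hypotheses (= the planner's certificate `GlueProof_rev17.lean` 40c90fc93fa85850 / this seat's `Split19002v3Sketch_g11.lean` f3af873556ea31b8):

* `oneSignUnitContent_of_child` — the one-sign unit-content rider at every odd `p` from C3 (`p ≥ 5`) and the PROVED input-free `p = 3`
  twin (`SmallImageCycWindingMuThree` p643729 + `SmallImageOrbitSumMuThree` p636964);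
* `threeLower_of_child` — the integral `∃ ε` Eisenstein half at `p = 3` from C4 (λ-part, both signs) and Mazur's period unit `h3`
  (`HorocycleMuFloor.X7.exists_kobayashiLowerDivisibility_three_of_pInverted`, p648511);
* `kobayashiMainConjectureSmallImage_of_children` — crux 4 BY NAME from C1–C5 (`SmallImageAcnsCrux.kobayashiMainConjectureSmallImage_of_acns`
  p621671 fed by `SmallImageAcanchorGlueRatRatNotCMCoprime.canonicalNs_of_eulerSystemRatNotCMCoprime_of_acDivRatNotCMCoprime_noSurj` p656230,
  the BRR 2022 Thm. 1 conjunct of C5 supplying the Heegner field with `p ∤ h_K`, and `InputsPublishedNs.publishedInputs_ns_of_five_of_mazur` p640631);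
* `kobayashiMainConjectureSmallImageOfAcnsParts_holds : KobayashiMainConjectureSmallImageOfAcnsParts` — the route decl, closing stmt-23120.

HONEST SCOPE: this is the COMPOSITION only. The five children are hypotheses of the glue and stay OPEN items (C1/C2 the engines —
¬Surj ∧ ¬CM ∧ a_p = 0 twins of 20728-rational / 20727-coprime, research; C3 one-signed μ at p ≥ 5, open class-wide; C4 the p-inverted
λ-part at 3, shared with crux 3; C5 the HELD/PRE cite bundle). Crux 4 is NOT proved; no summit statement / BSD case is proved by this file.

References: [Kobayashi2003] Conjecture p. 2, Thm. 4.1; [BurungaleCastellaSkinner2025] Prop. 4.2.2; [BurungaleSkinnerTianWan2024] Thm. 6.17,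
Props. 1.18/2.7/5.19 (PRE), Thm. 9.24; [BeckwithRaumRichter2022] Thm. 1; [Mazur1978] Cor. 4.1; tree: `Lines/birth_acns.lean` v13,
`Theses/SignedLowerHalves.lean` rev 17 ll. 259–357.
-/

-- D-0017: single-problem summit, the namespace repeats the problem name by design.
set_option linter.dupNamespace false
set_option autoImplicit false

noncomputable section

namespace Summit.BirchSwinnertonDyer.BirchSwinnertonDyer.Theorems.SmallImageAcnsParts

open CongruenceSubgroup Literature.NumberTheory.EllipticCurves Literature.NumberTheory.EllipticCurves.Rank1Residual
  Literature.NumberTheory.EllipticCurves.ModularForms Literature.NumberTheory.EllipticCurves.Kobayashi2003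
  Literature.NumberTheory.EllipticCurves.GreenbergVatsal2000
  Literature.NumberTheory.EllipticCurves.BurungaleSkinnerTianWan2024
  Literature.NumberTheory.EllipticCurves.BurungaleCastellaSkinner2025
  Summit.BirchSwinnertonDyer.Rank1Residual.Supersingular
  Summit.BirchSwinnertonDyer.BirchSwinnertonDyer.Theses.SignedLowerHalves

/-- **The one-sign unit-content rider at every odd `p`** from child C3 (`SmallImageOneSignUnitContent`, `p ≥ 5`) and the PROVED
input-free `p = 3` twin (THEOREM B road on Vaserstein's theorem: `exists_unit_norm_ratPlusSymbol_three_eq_one_of_isNewformOf` +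
`exists_sign_hasUnitContent_three_of_norm_ratPlusSymbol_eq_one`) — line v13's `BirthAcns.muOneSign_of_stubs` with the stub as a hypothesis.
[cite: Kobayashi2003, (3.6) (p. 7) and Conjecture (Main Conjecture) (p. 2)] -/
theorem oneSignUnitContent_of_child (h3 : SmallImageOneSignUnitContent) :
    ∀ (W : WeierstrassCurve ℚ) [W.IsElliptic] [W.IsGloballyMinimal] (p : ℕ) [Fact p.Prime],
      p ≠ 2 → ClassX7 W p → ¬ W.HasCM → W.frobeniusTrace p = 0 → ¬ Surj W p →
      ∀ [NeZero (W.conductorNorm ℤ)] (f : CuspForm (Gamma0 (W.conductorNorm ℤ)) 2),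
      IsNewformOf W f → ∃ (ε₀ : ℤˣ) (L₀ : IwasawaAlgebra p),
        IsSignedPAdicLFunction f p ε₀ L₀ ∧ HasUnitContent L₀ := by
  intro W _ _ p _ hp2 hX hCM hap hs _ f hf
  have hpP : p.Prime := Fact.out
  by_cases h3p : p = 3
  · subst h3p
    obtain ⟨n, u, hunit⟩ :=
      Summit.BirchSwinnertonDyer.BirchSwinnertonDyer.Theorems.SmallImageCycWindingMuThree.exists_unit_norm_ratPlusSymbol_three_eq_one_of_isNewformOf
        f hf hX.1.1 hap
    exact Summit.BirchSwinnertonDyer.BirchSwinnertonDyer.Theorems.SmallImageOrbitSumMuThree.exists_sign_hasUnitContent_three_of_norm_ratPlusSymbol_eq_one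
      f hf hX.1.1 hap u hunit
  · have h5 : 5 ≤ p := by
      rcases hpP.eq_two_or_odd' with h | h
      · exact absurd h hp2
      · have h2 := hpP.two_le
        by_contra hlt
        interval_cases p <;> simp_all (config := {decide := true})
    exact h3 W p h5 hX hCM hap hs f hf

/-- **The INTEGRAL `p = 3` Eisenstein half `∃ ε, KobayashiLowerDivisibility W 3 ε`** on the crux's `p = 3` rows from child C4
(`SmallImageLambdaLowerAtThree`, the `p`-inverted λ-part for both signs) and the period unit `h3` (Mazur 1978 Cor. 4.1 through the INPUTS
desk), by the image-free `HorocycleMuFloor.X7.exists_kobayashiLowerDivisibility_three_of_pInverted` (μ-side = the input-free `p = 3` rider) —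
line v13's `BirthAcns.threeLower_of_stubs` with the stub as a hypothesis. [cite: Kobayashi2003, Conjecture (Main Conjecture) (p. 2) and Thm. 4.1 (p. 8)]
[cite: Mazur1978, Cor. 4.1] -/
theorem threeLower_of_child (h4 : SmallImageLambdaLowerAtThree) (h3r : realPeriodRat_eq_unit_mul_plusPeriod_three) :
    ∀ (W : WeierstrassCurve ℚ) [W.IsElliptic] [W.IsGloballyMinimal] (p : ℕ) [Fact p.Prime],
      p = 3 → ClassX7 W p → ¬ W.HasCM → W.frobeniusTrace p = 0 → ¬ Surj W p →
      ∃ ε : ℤˣ, KobayashiLowerDivisibility W p ε := by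
  intro W _ _ p _ hp3 hX hCM hap hs
  subst hp3
  exact Summit.BirchSwinnertonDyer.BirchSwinnertonDyer.Theorems.HorocycleMuFloor.X7.exists_kobayashiLowerDivisibility_three_of_pInverted
    W h3r hX hap (fun ε ↦ h4 W 3 rfl hX hCM hap hs ε)

/-- **Crux 4 `KobayashiMainConjectureSmallImage` from the five children C1–C5** — line `birth_acns` v13's composition
`BirthAcns.KobayashiMainConjectureSmallImage_of` with the stubs as hypotheses: the HELD five prints ∧ Mazur give the seven-conjunct bundle
(`InputsPublishedNs.publishedInputs_ns_of_five_of_mazur`); T3 (`CanonicalNs`) comes from C1 ∧ C2 by the v13 glue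
`SmallImageAcanchorGlueRatRatNotCMCoprime.canonicalNs_of_eulerSystemRatNotCMCoprime_of_acDivRatNotCMCoprime_noSurj` fed by the BRR 2022 Thm. 1
conjunct of C5 (the Heegner field with `p ∤ h_K`); then `SmallImageAcnsCrux.kobayashiMainConjectureSmallImage_of_acns` (5 ≤ p: T3 + one-sign μ +
held inputs ⇒ lower at the rider's sign, saturation at every sign; p = 3: the Eisenstein half + saturation).
[cite: BurungaleCastellaSkinner2025, Prop. 4.2.2 (§4.2, p. 9 of arXiv:2405.00270v2)] [cite: BurungaleSkinnerTianWan2024, Thm. 9.24]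
[cite: BeckwithRaumRichter2022, Theorem 1] [cite: Kobayashi2003, Thm. 4.1 (p. 8)] -/
theorem kobayashiMainConjectureSmallImage_of_children (h1 : SmallImageEulerSystemRat) (h2 : SmallImageAcDivRat)
    (h3 : SmallImageOneSignUnitContent) (h4 : SmallImageLambdaLowerAtThree) (h5 : SmallImagePublishedPreprintInputs) :
    KobayashiMainConjectureSmallImage := by
  obtain ⟨h41, h12, h5r, h3r, hCK, hmodP, h422⟩ :=
    Summit.BirchSwinnertonDyer.BirchSwinnertonDyer.Theorems.SignedLowerHalves.InputsPublishedNs.publishedInputs_ns_of_five_of_mazur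
      h5.1.1 h5.1.2.1
  exact Summit.BirchSwinnertonDyer.BirchSwinnertonDyer.Theorems.SmallImageAcnsCrux.kobayashiMainConjectureSmallImage_of_acns
    hCK h12 h41 h5r h3r hmodP h422 h5.2.2 h5.2.1
    (Summit.BirchSwinnertonDyer.BirchSwinnertonDyer.Theorems.SmallImageAcanchorGlueRatRatNotCMCoprime.canonicalNs_of_eulerSystemRatNotCMCoprime_of_acDivRatNotCMCoprime_noSurj
      h5.1.2.2 h1 h2)
    (oneSignUnitContent_of_child h3) (threeLower_of_child h4 h3r)

/-- **The glue item stmt-BirchSwinnertonDyer-23120 `KobayashiMainConjectureSmallImageOfAcnsParts`, PROVED**: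
`C1 → C2 → C3 → C4 → C5 → KobayashiMainConjectureSmallImage` — the route decl verbatim. The children are hypotheses; crux 4 itself stays
OPEN until the five children close. [cite: Kobayashi2003, Conjecture (Main Conjecture) (p. 2)] -/
theorem kobayashiMainConjectureSmallImageOfAcnsParts_holds :
    Summit.BirchSwinnertonDyer.BirchSwinnertonDyer.Theses.SignedLowerHalves.KobayashiMainConjectureSmallImageOfAcnsParts := by
  unfold Summit.BirchSwinnertonDyer.BirchSwinnertonDyer.Theses.SignedLowerHalves.KobayashiMainConjectureSmallImageOfAcnsParts
  exact fun h1 h2 h3 h4 h5 => kobayashiMainConjectureSmallImage_of_children h1 h2 h3 h4 h5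

end Summit.BirchSwinnertonDyer.BirchSwinnertonDyer.Theorems.SmallImageAcnsParts

end
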